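import Summits.ResolutionOfSingularities.ResolutionOfSingularities.Theorems.WeightedInvariantLocalWeightedDropNCGameRank
import Summits.ResolutionOfSingularities.ResolutionOfSingularities.Theorems.WeightedInvariantLocalWeightedDropSpaceNCCountOfCJSB
import Summits.ResolutionOfSingularities.ResolutionOfSingularities.Theorems.WeightedInvariantLocalWeightedDropMonomialPhase
import Summits.ResolutionOfSingularities.ResolutionOfSingularities.Theorems.WeightedInvariantLocalWeightedDropTameResidualOfTupleDrop

/-!
# `WeightedInvariant.LocalWeightedDrop`: T″|₄ from an ORDINAL NC-rank on surface germs — the ordinal tuple-game assembly and the composition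

Crux item stmt-ResolutionOfSingularities-8899 `LocalWeightedDrop` (route `ResolutionOfSingularities/WeightedInvariant`), ENGINE skeleton v31
(fb48e93459d3708f), residual `stub_tameWideApexFourStartsWon` (T″|₄).  [OURS · L1 W4.3 · chain w43 · lead-1 gen 4 (engine registrar); second half
of `…NCGameRank.lean` (transfinite winnability `WinsOrd`, game rank `rank_of_winsOrd`, interface `winsOrd_of_rankDrop`).  The games are the
programme's own; nothing here is a statement of any manuscript.  AI-produced, gate-checked, weaker than expert review.]

* `tupleDrop_of_rank_of_monomialPhase` — the ORDINAL form of the tuple-game assembly `tupleDrop_of_count_of_monomialPhase` (p501911; rank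
  `β · ν (prodSupport a) + μ a` in ordinal arithmetic, `count_clause_ordinal`);
* `tupleDropThree_of_ncRankDrop`, **`tameWideApexFourStartsWon_of_ncRankDrop`** — T″|₄ VERBATIM from «one ordinal rank on `k⟦x₀,x₁,x₂⟧` that
  some smooth-centre move lowers at every exceptional point of every non-zero germ whose support is not a normal crossing» over algebraically
  closed fields of characteristic `p` (through the landed `stub_spaceMonomialPhase` p506875 and `tameWideApexFourStartsWon_of_tupleDrop` p500325);
* `ncRankDrop_of_winsIn`, `ncRankDrop_of_CJSB` — the interface follows from (TOT₂) `∀ b ≠ 0, ∃ n, WinsIn GermIsNC n b`, hence from ⟨F-32bR⟩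
  (`exists_winsIn_germIsNC_of_CJSB`): the banked status of T″|₄ is unchanged; the new target is WEAKER than (TOT₂) (no uniform round bound).
-/

set_option linter.dupNamespace false -- mandated namespace of this single-conjunct summit

noncomputable section

namespace Summit.ResolutionOfSingularities.ResolutionOfSingularities.Theorems

namespace TameFourTupleDrop

open MvPowerSeries Literature.AlgebraicGeometry.Resolution

variable {k : Type} [Field k] {m : ℕ}


/-! ## The ordinal tuple-game assembly -/

/-- Lexicographic comparison of `β · ν + x` with `x < β`, ordinal first component. -/
theorem mul_add_lt_of_lt_ordinal {ν ν' β x : Ordinal.{0}} (y : Ordinal.{0}) (hx : x < β) (h : ν < ν') :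
    β * ν + x < β * ν' + y :=
  calc β * ν + x
      < β * ν + β := (add_lt_add_iff_left _).mpr hx
    _ = β * (ν + 1) := by rw [mul_add_one]
    _ ≤ β * ν' := mul_le_mul_right (Order.add_one_le_of_lt h) _
    _ ≤ _ := le_self_add

/-- THE COUNT CLAUSE for an ORDINAL count (as `TupleDropAssembly.count_clause`). -/
theorem count_clause_ordinal {e : ℕ} (ν : MvPowerSeries (Fin (m + 1)) k → Ordinal.{0})
    (hν2 : ∀ b d : MvPowerSeries (Fin (m + 1)) k, d ≠ 0 → ∀ N : ℕ, b ∣ d ^ (N + 1) → ν b ≤ ν d)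
    (a : Fin (e + 1) → MvPowerSeries (Fin (m + 1)) k)
    (Φ : Fin (m + 1) → MvPowerSeries (Fin (m + 1)) k) (hΦ0 : ∀ i, constantCoeff (Φ i) = 0)
    (w : Fin (m + 1) → ℕ) (hw1 : ∀ i, w i ≤ 1)
    (hmove : ∀ c : Fin (m + 1) → k, (∀ i, w i = 0 → c i = 0) → c ≠ 0 →
      ∀ (A : ℕ) (G : MvPowerSeries (Fin (m + 1 + 1)) k),
        subst (CobordantChart.chart w c) (subst Φ (TupleGame.prodSupport a)) = X 0 ^ A * G →
        ¬ (X (0 : Fin (m + 1 + 1)) ∣ G) →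
        ∃ i : Fin (m + 1), c i ≠ 0 ∧ ν (X 0 * TupleGame.slice i G) < ν (TupleGame.prodSupport a))
    (c : Fin (m + 1) → k) (hc : ∀ i, w i = 0 → c i = 0) (hc0 : c ≠ 0) (D : Fin (e + 1) → ℕ)
    (G : Fin (e + 1) → MvPowerSeries (Fin (m + 1 + 1)) k)
    (hfac : ∀ j, a j ≠ 0 →
      subst (CobordantChart.chart w c) (subst Φ (a j)) = X 0 ^ D j * G j ∧ ¬ X 0 ∣ G j) :
    ∃ i : Fin (m + 1), c i ≠ 0 ∧
      ν (TupleGame.prodSupport (TupleGame.newTuple a D G i)) < ν (TupleGame.prodSupport a) := by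
  classical
  obtain ⟨hprod, hndvd⟩ := TupleDropAssembly.subst_chart_subst_prodSupport a Φ hΦ0 w c hc D G hfac
  obtain ⟨i, hci, hlt⟩ := hmove c hc hc0 _ _ hprod hndvd
  refine ⟨i, hci, lt_of_le_of_lt (hν2 _ _ ?_ _ (TupleDropAssembly.prodSupport_newTuple_dvd a D G i)) hlt⟩
  exact mul_ne_zero (MvPowerSeries.prime_X' k (0 : Fin (m + 1))).ne_zero
    (TupleDropAssembly.slice_ne_zero _ w c hc hw1 _ _ hprod hndvd i hci)

/-- **THE TUPLE GAME FROM AN ORDINAL RADICAL COUNT AND A MONOMIAL PHASE** (the ordinal form of `tupleDrop_of_count_of_monomialPhase`,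
every field, every number `m + 1` of variables, every predicate `P`).  Rank: `κ a := β · ν (prodSupport a) + μ a`. -/
theorem tupleDrop_of_rank_of_monomialPhase (m : ℕ)
    (P : MvPowerSeries (Fin (m + 1)) k → Prop) (ν : MvPowerSeries (Fin (m + 1)) k → Ordinal.{0})
    (hν1 : ∀ b : MvPowerSeries (Fin (m + 1)) k, b ≠ 0 → (ν b = 0 ↔ P b))
    (hν2 : ∀ b d : MvPowerSeries (Fin (m + 1)) k, d ≠ 0 → ∀ N : ℕ, b ∣ d ^ (N + 1) → ν b ≤ ν d)
    (hν3 : ∀ b : MvPowerSeries (Fin (m + 1)) k, b ≠ 0 → ¬ P b →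
      ∃ (Φ : Fin (m + 1) → MvPowerSeries (Fin (m + 1)) k) (w : Fin (m + 1) → ℕ),
        (∀ i, MvPowerSeries.constantCoeff (Φ i) = 0) ∧
        IsUnit (Matrix.det (Matrix.of fun i j => MvPowerSeries.coeff (Finsupp.single j 1) (Φ i))) ∧
        (∀ i, w i ≤ 1) ∧ (∃ i, 0 < w i) ∧
        ∀ c : Fin (m + 1) → k, (∀ i, w i = 0 → c i = 0) → c ≠ 0 →
          ∀ (A : ℕ) (G : MvPowerSeries (Fin (m + 1 + 1)) k),
            MvPowerSeries.subst (CobordantChart.chart w c) (MvPowerSeries.subst Φ b) = MvPowerSeries.X 0 ^ A * G →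
            ¬ (MvPowerSeries.X (0 : Fin (m + 1 + 1)) ∣ G) →
            ∃ i : Fin (m + 1), c i ≠ 0 ∧ ν (MvPowerSeries.X 0 * TupleGame.slice i G) < ν b)
    (hmono : ∀ e : ℕ, ∃ (β : Ordinal.{0}) (μ : (Fin (e + 1) → MvPowerSeries (Fin (m + 1)) k) → Ordinal.{0}),
      (∀ a, μ a < β) ∧
      ∀ a : Fin (e + 1) → MvPowerSeries (Fin (m + 1)) k, a ≠ 0 → TupleGame.Bad a →
        P (TupleGame.prodSupport a) →
        TupleGame.StepDrop μ (fun b => P (TupleGame.prodSupport b)) a) :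
    ∀ e : ℕ, TupleGame.Drop k (m + 1) e := by
  intro e
  obtain ⟨β, μ, hμlt, hμstep⟩ := hmono e
  refine ⟨fun a => β * ν (TupleGame.prodSupport a) + μ a, ?_⟩
  intro a ha hbad
  by_cases hP : P (TupleGame.prodSupport a)
  · -- good support product: the monomial phase's move; `ν` stays `0`, `μ` drops
    obtain ⟨Φ, w, hΦ0, hdet, hw1, hwpos, hstep⟩ := hμstep a ha hbad hP
    refine ⟨Φ, w, hΦ0, hdet, hw1, hwpos, ?_⟩
    intro c hc hc0 D G hfac
    obtain ⟨i, hci, hi⟩ := hstep c hc hc0 D G hfac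
    refine ⟨i, hci, fun hne hbad' => ⟨trivial, ?_⟩⟩
    obtain ⟨hPnew, hμlt'⟩ := hi hne hbad'
    have h1 : ν (TupleGame.prodSupport (TupleGame.newTuple a D G i)) = 0 :=
      (hν1 _ (TupleGame.prodSupport_ne_zero _)).mpr hPnew
    have h2 : ν (TupleGame.prodSupport a) = 0 := (hν1 _ (TupleGame.prodSupport_ne_zero _)).mpr hP
    dsimp only
    rw [h1, h2]
    exact (add_lt_add_iff_left _).mpr hμlt'
  · -- bad support product: the count's move for `b := prodSupport a`; `ν` drops at every successor
    obtain ⟨Φ, w, hΦ0, hdet, hw1, hwpos, hmove⟩ := hν3 _ (TupleGame.prodSupport_ne_zero a) hP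
    refine ⟨Φ, w, hΦ0, hdet, hw1, hwpos, ?_⟩
    intro c hc hc0 D G hfac
    obtain ⟨i, hci, hlt⟩ := count_clause_ordinal ν hν2 a Φ hΦ0 w hw1 hmove c hc hc0 D G hfac
    exact ⟨i, hci, fun _ _ => ⟨trivial, mul_add_lt_of_lt_ordinal _ (hμlt _) hlt⟩⟩

/-! ## T″|₄ from the interface at `k⟦x₀,x₁,x₂⟧` -/

/-- **THE THREE-VARIABLE TUPLE GAME FROM AN ORDINAL NC-RANK THAT SOME MOVE LOWERS** (every field): if one ordinal rank on
`k⟦x₀,x₁,x₂⟧` is lowered at every exceptional point of some smooth-centre move from every non-zero germ whose support is not a normal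
crossing, then `TupleGame.Drop k 3 e` for every `e` (game rank ⇒ ordinal count (i)(ii)(iii) ⇒ the ordinal assembly with the landed monomial
phase `stub_spaceMonomialPhase`). -/
theorem tupleDropThree_of_ncRankDrop (k : Type) [Field k]
    (hdrop : ∃ ρ : MvPowerSeries (Fin 3) k → Ordinal.{0}, ∀ b : MvPowerSeries (Fin 3) k, b ≠ 0 → ¬ GermIsNC b →
      ∃ (Φ : Fin 3 → MvPowerSeries (Fin 3) k) (w : Fin 3 → ℕ),
        IsCountMove (m := 2) Φ w ∧ MoveClause (m := 2) b Φ w (fun b' => ρ b' < ρ b)) :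
    ∀ e : ℕ, TupleGame.Drop k 3 e := by
  obtain ⟨ρ, hρ⟩ := hdrop
  have hwin := winsOrd_of_rankDrop (m := 2) (P := GermIsNC) ρ hρ
  have hP : ∀ (N : ℕ) (b d : MvPowerSeries (Fin 3) k), d ≠ 0 → GermIsNC d → b ∣ d ^ (N + 1) → GermIsNC b :=
    fun N b d hd hnc hdvd => germIsNC_of_dvd_pow N b d hd hnc hdvd
  obtain ⟨ν, h1, h2, h3⟩ := rank_of_winsOrd (m := 2) GermIsNC hP hwin
  obtain hmono := stub_spaceMonomialPhase k
  exact tupleDrop_of_rank_of_monomialPhase 2 GermIsNC ν h1 h2 h3 hmono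

/-- **T″|₄ — THE N = 4 TAME RESIDUAL OF THE ENGINE — FROM AN ORDINAL NC-RANK ON SURFACE GERMS THAT SOME SMOOTH-CENTRE MOVE LOWERS**:
the registered stub `stub_tameWideApexFourStartsWon` of skeleton v31 (fb48e93459d3708f), statement VERBATIM as the conclusion, from the
hypothesis «over every algebraically closed field of characteristic `p`, one ordinal rank on `k⟦x₀,x₁,x₂⟧` drops at every exceptional point of
some smooth-centre move from every non-zero germ whose support is not a normal crossing» — positional embedded normal-crossings resolution of
surface germs in a regular threefold germ, ordinal form (weaker than (TOT₂)'s uniform round bound).  [OURS · L1 W4.3] -/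
theorem tameWideApexFourStartsWon_of_ncRankDrop
    (hdrop : ∀ (p : ℕ), p.Prime → ∀ (k : Type) [Field k] [CharP k p] [IsAlgClosed k],
      ∃ ρ : MvPowerSeries (Fin 3) k → Ordinal.{0}, ∀ b : MvPowerSeries (Fin 3) k, b ≠ 0 → ¬ GermIsNC b →
        ∃ (Φ : Fin 3 → MvPowerSeries (Fin 3) k) (w : Fin 3 → ℕ),
          IsCountMove (m := 2) Φ w ∧ MoveClause (m := 2) b Φ w (fun b' => ρ b' < ρ b)) :
    ∀ (p : ℕ), p.Prime → ∀ (k : Type) [Field k] [CharP k p] [IsAlgClosed k],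
    (∀ m : ℕ, m < 4 → ∀ g : MvPowerSeries (Fin m) k,
      CobordantGame.IsSingular k g → CobordantGame.Won k m g) →
    ∀ (f : MvPowerSeries (Fin 4) k), CobordantGame.IsSingular k f →
    (∀ g : MvPowerSeries (Fin 4) k, CobordantGame.IsSingular k g → g.order < f.order →
      CobordantGame.Won k 4 g) →
    ∀ (d : ℕ), f.order = d → ¬ p ∣ d →
    (∃ ℓ : Fin 4 → k, ∀ i j : Fin 4,
      MvPowerSeries.coeff (Finsupp.single i 1 + Finsupp.single j 1) f =
        MvPowerSeries.coeff (Finsupp.single i 1 + Finsupp.single j 1)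
          ((∑ l, MvPowerSeries.C (ℓ l) * MvPowerSeries.X l) ^ 2)) →
    (2 < d → ∃ c₁ c₂ : Fin 4 → k, (∀ α β : k, α • c₁ + β • c₂ = 0 → α = 0 ∧ β = 0) ∧
      (∀ v : Fin 4 → k, CobordantChart.initEval (fun _ : Fin 4 => 1) (v + c₁) d f =
        CobordantChart.initEval (fun _ : Fin 4 => 1) v d f) ∧
      (∀ v : Fin 4 → k, CobordantChart.initEval (fun _ : Fin 4 => 1) (v + c₂) d f =
        CobordantChart.initEval (fun _ : Fin 4 => 1) v d f)) →
    CobordantGame.Won k 4 f :=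
  tameWideApexFourStartsWon_of_tupleDrop fun p hp k _ _ _ e => tupleDropThree_of_ncRankDrop k (hdrop p hp k) e

/-! ## The interface follows from (TOT₂), hence from ⟨F-32bR⟩ -/

/-- (TOT₂) ⇒ THE INTERFACE: a uniform finite round bound gives the ordinal rank (the least number of rounds). -/
theorem ncRankDrop_of_winsIn (k : Type) [Field k]
    (htot : ∀ b : MvPowerSeries (Fin 3) k, b ≠ 0 → ∃ n, WinsIn (m := 2) GermIsNC n b) :
    ∃ ρ : MvPowerSeries (Fin 3) k → Ordinal.{0}, ∀ b : MvPowerSeries (Fin 3) k, b ≠ 0 → ¬ GermIsNC b →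
      ∃ (Φ : Fin 3 → MvPowerSeries (Fin 3) k) (w : Fin 3 → ℕ),
        IsCountMove (m := 2) Φ w ∧ MoveClause (m := 2) b Φ w (fun b' => ρ b' < ρ b) := by
  refine ⟨fun b => ((depth (m := 2) GermIsNC htot b : ℕ) : Ordinal.{0}), fun b hb hnc => ?_⟩
  obtain ⟨Φ, w, hmv, hcl⟩ := exists_move_depth_lt (m := 2) GermIsNC htot hb hnc
  exact ⟨Φ, w, hmv, hcl.mono fun g hg => by dsimp only; exact_mod_cast hg⟩

/-- ⟨F-32bR⟩ ⇒ THE INTERFACE (through `exists_winsIn_germIsNC_of_CJSB`): the banked status of T″|₄ modulo the corrected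
Cossart–Jannsen–Saito sequence fact is unchanged by the re-keying. -/
theorem ncRankDrop_of_CJSB (hCJS : CossartJannsenSaito2020EmbeddedSequenceB.{0}) (k : Type) [Field k] :
    ∃ ρ : MvPowerSeries (Fin 3) k → Ordinal.{0}, ∀ b : MvPowerSeries (Fin 3) k, b ≠ 0 → ¬ GermIsNC b →
      ∃ (Φ : Fin 3 → MvPowerSeries (Fin 3) k) (w : Fin 3 → ℕ),
        IsCountMove (m := 2) Φ w ∧ MoveClause (m := 2) b Φ w (fun b' => ρ b' < ρ b) :=
  ncRankDrop_of_winsIn k fun b hb => exists_winsIn_germIsNC_of_CJSB hCJS b hb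

end TameFourTupleDrop

end Summit.ResolutionOfSingularities.ResolutionOfSingularities.Theorems

end
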